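import Mathlib.GroupTheory.PGroup
import Mathlib.GroupTheory.GroupAction.ConjAct
import Mathlib.GroupTheory.Commutator.Basic
import HarnessLib

/-!
# A non-trivial normal subgroup of a finite `p`-group meets the centre; a normal subgroup of order `p` is central (Murthy 2026, Lemma 2.15)

Topic `Literature/GroupTheory/Nilpotent` (finite `p`-groups; companion of `FrattiniCommutator.lean`).

S. R. Murthy, *On the triple product property for subgroups of finite nilpotent groups of class 2*,
arXiv:2602.15796v1 (2026), Lemma 2.15, p. 10, verbatim:

> **Lemma 2.15.** If `N` is a normal subgroup of a nonabelian `p`-group `G` such that `N` is cyclic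
> of order `p` then `N` is central, that is, `N ⊴ G` and `N ≅ Z_p` implies that `N ≤ Z(G)`. In
> particular, if `G` is a nonabelian `p`-group containing a cyclic commutator subgroup `G′` of order
> `p` then `G′` is central and `G` is of nilpotency class `2`.
> *Proof.* […] `G` acts on the elements of `N` by conjugation […] and produces conjugacy classes
> […] that partition `N`. […] each conjugacy class size `|n^G|` must divide `|G|` and is therefore
> either `1` or `p`. This implies that every non-identity element of `N` also forms a singleton
> conjugacy class […] which proves that `N ≤ Z(G)`. […]

(The hypothesis "nonabelian" is not needed and is dropped below.)

## What is here (all proved; 0 definitions, 0 named facts)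

* `IsPGroup.exists_ne_one_mem_center_of_normal` — the class-equation step in general form: a
  non-trivial normal subgroup `N` of a finite `p`-group contains a non-identity CENTRAL element
  (`G` acts on `N` by conjugation, Mathlib's `Subgroup.conjMulDistribMulAction`; the fixed points are
  `N ∩ Z(G)`, and their number is `≡ |N| ≡ 0 (mod p)`, Mathlib's
  `IsPGroup.exists_fixed_point_of_prime_dvd_card_of_fixed_point`);
* `Murthy2026_lemma215` — **Lemma 2.15**: a normal subgroup of order `p` of a finite `p`-group is
  central;
* `Murthy2026_lemma215_commutator` — its "in particular": if `|G′| = p` then `G′ ≤ Z(G)` (so `G`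
  has class `≤ 2`).

## References
* S. R. Murthy, arXiv:2602.15796v1 (2026): Lemma 2.15 with proof, p. 10. [Murthy2026]
-/

namespace Literature.GroupTheory.Nilpotent

variable {G : Type*} [Group G] [Finite G] {p : ℕ} [hp : Fact p.Prime]

/-- **A non-trivial normal subgroup of a finite `p`-group meets the centre non-trivially**: if
`N ⊴ G`, `N ≠ 1` and `G` is a finite `p`-group, some `n ∈ N`, `n ≠ 1`, is central.  (Conjugation
action of `G` on `N`; its fixed points are the central elements of `N`, and their number is
`≡ |N| ≡ 0 (mod p)` while `1` is fixed.) [folklore] (the class-equation argument printed for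
`|N| = p` in [cite: Murthy2026, Lemma 2.15 (proof)]) -/
theorem IsPGroup.exists_ne_one_mem_center_of_normal (hG : IsPGroup p G) (N : Subgroup G)
    [hN : N.Normal] (hN1 : N ≠ ⊥) : ∃ n ∈ N, n ≠ 1 ∧ n ∈ Subgroup.center G := by
  have hpp := hp.out
  -- `p ∣ |N|`
  have hdvd : p ∣ Nat.card N := by
    obtain ⟨m, hm⟩ := IsPGroup.iff_card.1 hG
    obtain ⟨k, -, hk⟩ := (Nat.dvd_prime_pow hpp).1 (hm ▸ N.card_subgroup_dvd_card)
    have hk0 : k ≠ 0 := by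
      rintro rfl
      rw [pow_zero, Subgroup.card_eq_one] at hk
      exact hN1 hk
    rw [hk]
    exact dvd_pow_self p hk0
  -- the conjugation action of `G` (as `ConjAct G`) on `N` has a fixed point other than `1`
  have h1 : (1 : N) ∈ MulAction.fixedPoints (ConjAct G) N := fun g => by
    apply Subtype.ext
    rw [ConjAct.Subgroup.val_conj_smul, OneMemClass.coe_one, smul_one]
  obtain ⟨b, hb, hb1⟩ :=
    (hG.of_equiv ConjAct.toConjAct).exists_fixed_point_of_prime_dvd_card_of_fixed_point N hdvd h1
  refine ⟨b, b.2, fun h => hb1 (Subtype.ext h).symm, ?_⟩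
  -- a fixed point of the conjugation action is central
  rw [Subgroup.mem_center_iff]
  intro g
  have hgb := congrArg Subtype.val (hb (ConjAct.toConjAct g))
  rw [ConjAct.Subgroup.val_conj_smul, ConjAct.toConjAct_smul] at hgb
  -- `hgb : g * b * g⁻¹ = b`
  exact mul_inv_eq_iff_eq_mul.1 hgb

/-- **Murthy 2026, Lemma 2.15**: a normal subgroup `N` of order `p` of a finite `p`-group `G` is
central, `N ≤ Z(G)` (the printed hypothesis "nonabelian" is superfluous). [cite: Murthy2026, Lemma 2.15] -/
theorem Murthy2026_lemma215 (hG : IsPGroup p G) (N : Subgroup G) [N.Normal]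
    (hN : Nat.card N = p) : N ≤ Subgroup.center G := by
  have hpp := hp.out
  have hN1 : N ≠ ⊥ := by
    intro h
    rw [h, Subgroup.card_bot] at hN
    exact hpp.one_lt.ne hN
  obtain ⟨n, hnN, hn1, hnZ⟩ := IsPGroup.exists_ne_one_mem_center_of_normal hG N hN1
  -- `N = ⟨n⟩` since `|N| = p` is prime and `1 ≠ n ∈ N`
  have hzN : Subgroup.zpowers n = N := by
    refine Subgroup.eq_of_le_of_card_ge ((Subgroup.zpowers_le).2 hnN) ?_
    rw [hN, Nat.card_zpowers]
    have hdvd : orderOf n ∣ p := hN ▸ Subgroup.orderOf_dvd_natCard N hnN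
    rcases (Nat.dvd_prime hpp).1 hdvd with h1 | h1
    · exact absurd (orderOf_eq_one_iff.1 h1) hn1
    · exact h1.ge
  rw [← hzN]
  exact (Subgroup.zpowers_le).2 hnZ

/-- **Murthy 2026, Lemma 2.15, "in particular"**: if the commutator subgroup `G′` of a finite
`p`-group has order `p`, then `G′ ≤ Z(G)` — `G` has nilpotency class `≤ 2`.
[cite: Murthy2026, Lemma 2.15] -/
theorem Murthy2026_lemma215_commutator (hG : IsPGroup p G) (hG' : Nat.card (commutator G) = p) :
    commutator G ≤ Subgroup.center G :=
  Murthy2026_lemma215 hG (commutator G) hG'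

end Literature.GroupTheory.Nilpotent
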